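import Summits.ResolutionOfSingularities.ResolutionOfSingularities.Theorems.EquisingularLiftEquisingularLiftNatSpecimenCuspConeCharts
import Summits.ResolutionOfSingularities.ResolutionOfSingularities.Theorems.EquisingularLiftEquisingularLiftNatSpecimenCiNoseInstances
import HarnessLib

/-!
# [OURS · L1 W4.5(b) · EL♮(3)] The CUSPIDAL CUBIC CONE `x₀x₂² = x₃³` satisfies the downstairs hypothesis of the REGISTERED rung
# `stub_elnat_ciNoseThenPoints` with the double line `Σ = V(x₂, x₃)`, and EL♮ HOLDS for it through the rung — every characteristic
# (crux `EquisingularLiftNatThree` stmt-ResolutionOfSingularities-20148 / parent EL♮ stmt-…-20038)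

Cell `res-hironaka`, slot W4.5(b); width seat res-L1-w45b-nose-w3 (row «NOSE ENGINE CERT ‖ K», WIDTH TABLE D1′), rider to specimen 2
(`…NatSpecimenCuspConeAlgebra/Forms/Charts`). `--supports stmt-ResolutionOfSingularities-20148 --as helper`; closes nothing. OURS; NOT a statement of any
manuscript; AI-written, weaker than expert review. No definition, no `sorry`, standard axioms. Pattern: res-D-pv-013's
`WhitneyCubic.ciNoseThenPoints_hypothesis_whitneyCubic` (p522054) and `WhitneyCubic.elNatAt_whitneyCubic_of_ciNose` (`…NatSpecimenCiNoseInstances`), verbatim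
with `WhitneyCubic.form ↦ CuspCone.form` and res-D-pv-022's R2 downstairs regularity replaced by `CuspCone.isRegular_of_isBlowup_comap`.

WHY (census honesty): the certificate `CuspCone.reachNoseTowerBTriplePrime_cuspCone` places the cusp cone inside the B‴ nose predicate; this file records that
the specimen is ALREADY dispatched by the v6 CI-nose rung of the residue chain (`NoseHypCI`-class), i.e. it is a certification specimen, not a residue-class
nose — and, as a by-product, that **EL♮ holds for a surface with a NON-EQUIMULTIPLE double line** (a triple point on the nose): the chain's game asks only
for a liftable regular centre inside `ι(H)` and a regular end.

* `CuspCone.ciNoseThenPoints_hypothesis_cuspCone` — the `∃ (c, f, d, …)` block of the registered stub at `n = 3` for `H = V₊(x₀x₂² − x₃³)`, `c = 2`,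
  `f = (x₂, x₃)`, degrees `(1,1)`, ZERO point steps (any field `K`);
* `CuspCone.elNatAt_cuspCone_of_ciNose` — `ELNatAt p K 3 H ι` for `K` algebraically closed of characteristic `p` (ANY `p`), by the landed rung
  `stub_elnat_ciNoseThenPoints` (p524326) + `HypersurfaceSpecimen.locallyPrincipal_hypersurfaceι` + `elNatAt_of_horizAt`.
-/

set_option linter.dupNamespace false -- mandated namespace `Summit.<Summit>.<Problem>` of this single-conjunct summit

noncomputable section

open CategoryTheory CategoryTheory.Limits AlgebraicGeometry TopologicalSpace
open MvPolynomial HomogeneousLocalization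
open Literature.AlgebraicGeometry.Resolution
open Literature.AlgebraicGeometry.Motives Literature.AlgebraicGeometry.Motives.SmoothHypersurface
open Literature.AlgebraicGeometry.Motives.ProjectiveSpace
open AlgebraicGeometry.Scheme.IdealSheafData

namespace Summit.ResolutionOfSingularities.ResolutionOfSingularities.Cruxes.EquisingularLiftNat.Sections

namespace CuspCone

variable (k : Type) [Field k]

attribute [local instance] MvPolynomial.gradedAlgebra ProjBaseChange.algebraBase

/-- **THE CUSPIDAL CUBIC CONE SATISFIES THE DOWNSTAIRS HYPOTHESIS OF `stub_elnat_ciNoseThenPoints` AT `n = 3` WITH THE DOUBLE LINE `Σ`** (any field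
`K`): witnesses `c = 2`, `f = (x₂, x₃)`, degrees `(1,1)`, a blow-up `υ` of `ℙ³_K` along `𝓘(Σ) = ker Proj(f_K)`, and ZERO point steps — the reduced
strict transform `V(closure υ⁻¹(ι(H) ∖ Σ))_red` is regular (`LinearCentre.isRegular_reducedStrictTransform_of_blowupModel` over
`CuspCone.isRegular_of_isBlowup_comap`). Non-vacuity certificate for the rung on a nose with a NON-EQUIMULTIPLE point (the triple vertex).
[OURS · L1 W4.5b] [folklore] -/
theorem ciNoseThenPoints_hypothesis_cuspCone (K : Type) [Field K] :
    (letI := MvPolynomial.gradedAlgebra (σ := Fin (3 + 1)) (R := K); ∃ (c : ℕ) (f : Fin c → MvPolynomial (Fin (3 + 1)) K) (d : Fin c → ℕ), (∀ i, 1 ≤ d i ∧ f i ∈ MvPolynomial.homogeneousSubmodule (Fin (3 + 1)) K (d i)) ∧ Set.Nonempty {y : (Literature.AlgebraicGeometry.Motives.projectiveSpace 3 K).left | ∀ i, f i ∈ (y : ProjectiveSpectrum (MvPolynomial.homogeneousSubmodule (Fin (3 + 1)) K)).asHomogeneousIdeal} ∧ {y : (Literature.AlgebraicGeometry.Motives.projectiveSpace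 3 K).left | ∀ i, f i ∈ (y : ProjectiveSpectrum (MvPolynomial.homogeneousSubmodule (Fin (3 + 1)) K)).asHomogeneousIdeal} ⊆ Set.range (Literature.AlgebraicGeometry.Motives.SmoothHypersurface.hypersurfaceι (CuspCone.form K)).left ∧ ¬ (Set.range (Literature.AlgebraicGeometry.Motives.SmoothHypersurface.hypersurfaceι (CuspCone.form K)).left ⊆ {y : (Literature.AlgebraicGeometry.Motives.projectiveSpace 3 K).left | ∀ i, f i ∈ (y : ProjectiveSpectrum (MvPolynomial.homogeneousSubmodule (Fin (3 + 1)) K)).asHomogeneousIdeal}) ∧ (∀ y ∈ {y : (Literature.AlgebraicGeometry.Motives.projectiveSpace 3 K).left | ∀ i, f i ∈ (y : ProjectiveSpectrum (MvPolynomial.homogeneousSubmodule (Fin (3 + 1)) K)).asHomogeneousIdeal}, ∃ e : Fin c ↪ Fin (3 + 1), Matrix.det (Matrix.of fun i j => MvPolynomial.pderiv (e j) (f i)) ∉ (y : ProjectiveSpectrum (MvPolynomial.homogeneousSubmodule (Fin (3 + 1)) K)).asHomogeneousIdeal) ∧ ∃ (hSig : IsClosed {y : (Literature.AlgebraicGeometry.Motives.projectiveSpace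 3 K).left | ∀ i, f i ∈ (y : ProjectiveSpectrum (MvPolynomial.homogeneousSubmodule (Fin (3 + 1)) K)).asHomogeneousIdeal}) (F₂ : AlgebraicGeometry.Scheme.{0}) (υ : F₂ ⟶ (Literature.AlgebraicGeometry.Motives.projectiveSpace 3 K).left), Literature.AlgebraicGeometry.Resolution.IsBlowup υ (AlgebraicGeometry.Scheme.IdealSheafData.vanishingIdeal (⟨{y : (Literature.AlgebraicGeometry.Motives.projectiveSpace 3 K).left | ∀ i, f i ∈ (y : ProjectiveSpectrum (MvPolynomial.homogeneousSubmodule (Fin (3 + 1)) K)).asHomogeneousIdeal}, hSig⟩ : TopologicalSpace.Closeds (Literature.AlgebraicGeometry.Motives.projectiveSpace 3 K).left)) ∧ ∃ (F' : AlgebraicGeometry.Scheme.{0}) (ρ' : F' ⟶ F₂) (T' : Set F'), (∀ Q : (∀ F₁ : AlgebraicGeometry.Scheme.{0}, (F₁ ⟶ F₂) → Set F₁ → Prop), Q F₂ (CategoryTheory.CategoryStruct.id F₂) (closure (υ ⁻¹' (Set.range (Literature.AlgebraicGeometry.Motives.SmoothHypersurface.hypersurfaceι (CuspCone.form K)).left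 \ {y : (Literature.AlgebraicGeometry.Motives.projectiveSpace 3 K).left | ∀ i, f i ∈ (y : ProjectiveSpectrum (MvPolynomial.homogeneousSubmodule (Fin (3 + 1)) K)).asHomogeneousIdeal}))) → (∀ (F₁ F₃ : AlgebraicGeometry.Scheme.{0}) (ρ : F₁ ⟶ F₂) (T₁ : Set F₁) (x : ↥((AlgebraicGeometry.Scheme.IdealSheafData.vanishingIdeal (⟨closure T₁, isClosed_closure⟩ : TopologicalSpace.Closeds F₁))).subscheme) (υ₁ : F₃ ⟶ F₁) (hx : IsClosed ({(((AlgebraicGeometry.Scheme.IdealSheafData.vanishingIdeal (⟨closure T₁, isClosed_closure⟩ : TopologicalSpace.Closeds F₁))).subschemeι x : F₁)} : Set F₁)), Q F₁ ρ T₁ → ¬ IsRegularLocalRing (((AlgebraicGeometry.Scheme.IdealSheafData.vanishingIdeal (⟨closure T₁, isClosed_closure⟩ : TopologicalSpace.Closeds F₁))).subscheme.presheaf.stalk x) → Literature.AlgebraicGeometry.Resolution.IsBlowup υ₁ (AlgebraicGeometry.Scheme.IdealSheafData.vanishingIdeal (⟨{(((AlgebraicGeometry.Scheme.IdealSheafData.vanishingIdeal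 (⟨closure T₁, isClosed_closure⟩ : TopologicalSpace.Closeds F₁))).subschemeι x : F₁)}, hx⟩ : TopologicalSpace.Closeds F₁)) → Q F₃ (CategoryTheory.CategoryStruct.comp υ₁ ρ) (closure (υ₁ ⁻¹' (T₁ \ {(((AlgebraicGeometry.Scheme.IdealSheafData.vanishingIdeal (⟨closure T₁, isClosed_closure⟩ : TopologicalSpace.Closeds F₁))).subschemeι x : F₁)})))) → Q F' ρ' T') ∧ Literature.AlgebraicGeometry.Resolution.Scheme.IsRegular (AlgebraicGeometry.Scheme.IdealSheafData.vanishingIdeal (⟨closure T', isClosed_closure⟩ : TopologicalSpace.Closeds F')).subscheme) := by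
  classical
  obtain ⟨fk, hfk', hfkC, hfkX⟩ := EquisingularLift.StrataSplit.LinearCentre.exists_kill K 1 2
  haveI := isIntegral_hypersurface K
  haveI : IsLocallyNoetherian (Literature.AlgebraicGeometry.Motives.projectiveSpace (2 + 1) K).left :=
    EquisingularLift.StrataSplit.LinearCentre.isLocallyNoetherian_proj K (1 + 2)
  -- the blow-up of `ℙ³_k` along `Λ = ker Proj(f_k) = 𝓘(Σ)`
  obtain ⟨F₂, υ, hυ⟩ := exists_isBlowup (Proj (homogeneousSubmodule (Fin (1 + 2 + 1)) K)) (Proj.map fk hfk').ker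
  have hΛ := WhitneyCubic.ker_projMap_kill_eq_vanishingIdeal_doubleLine K fk hfk' hfkC hfkX (WhitneyCubic.isClosed_doubleLine K)
  have hsupp := WhitneyCubic.support_ker_projMap_kill_eq_doubleLine K fk hfk' hfkC hfkX
  -- the reduced strict transform is regular (zero point steps)
  have hreg : Scheme.IsRegular (vanishingIdeal (⟨closure (υ ⁻¹' (Set.range (hypersurfaceι (CuspCone.form K)).left \
      ((Proj.map fk hfk').ker.support : Set (Proj (homogeneousSubmodule (Fin (1 + 2 + 1)) K))))), isClosed_closure⟩ :
      Closeds F₂)).subscheme :=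
    EquisingularLift.StrataSplit.LinearCentre.isRegular_reducedStrictTransform_of_blowupModel (hypersurfaceι (CuspCone.form K)).left
      (Proj.map fk hfk').ker (not_range_subset_support K fk hfk' hfkC hfkX)
      (fun Z ρ hρ => isRegular_of_isBlowup_comap K fk hfk' hfkC hfkX Z ρ hρ) υ hυ
  refine ⟨2, ![X 2, X 3], ![1, 1], ?_, ⟨_, WhitneyCubic.genericPoint_mem_doubleLine K⟩, doubleLine_subset_range_ι K,
    not_range_ι_subset_doubleLine K, fun y _ => WhitneyCubic.jacobian_clause_doubleLine K y, WhitneyCubic.isClosed_doubleLine K, F₂, υ, ?_,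
    F₂, 𝟙 F₂, _, fun Q h0 _ => h0, ?_⟩
  · intro i
    fin_cases i <;> exact ⟨le_rfl, (mem_homogeneousSubmodule _ _).mpr (isHomogeneous_X K _)⟩
  · rw [← hΛ]
    exact hυ
  · rw [hsupp] at hreg
    have e : (⟨closure (closure (υ ⁻¹' (Set.range (hypersurfaceι (CuspCone.form K)).left \
        {y : (Literature.AlgebraicGeometry.Motives.projectiveSpace 3 K).left |
      ∀ i, (![X 2, X 3] : Fin 2 → MvPolynomial (Fin (3 + 1)) K) i ∈
        (y : ProjectiveSpectrum (MvPolynomial.homogeneousSubmodule (Fin (3 + 1)) K)).asHomogeneousIdeal}))),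
        isClosed_closure⟩ : Closeds F₂) = ⟨closure (υ ⁻¹' (Set.range (hypersurfaceι (CuspCone.form K)).left \
        {y : (Literature.AlgebraicGeometry.Motives.projectiveSpace 3 K).left |
      ∀ i, (![X 2, X 3] : Fin 2 → MvPolynomial (Fin (3 + 1)) K) i ∈
        (y : ProjectiveSpectrum (MvPolynomial.homogeneousSubmodule (Fin (3 + 1)) K)).asHomogeneousIdeal})),
        isClosed_closure⟩ := Closeds.ext closure_closure
    have hreg' : Scheme.IsRegular (vanishingIdeal (⟨closure (closure (υ ⁻¹' (Set.range (hypersurfaceι (CuspCone.form K)).left \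
        {y : (Literature.AlgebraicGeometry.Motives.projectiveSpace 3 K).left |
      ∀ i, (![X 2, X 3] : Fin 2 → MvPolynomial (Fin (3 + 1)) K) i ∈
        (y : ProjectiveSpectrum (MvPolynomial.homogeneousSubmodule (Fin (3 + 1)) K)).asHomogeneousIdeal}))),
        isClosed_closure⟩ : Closeds F₂)).subscheme := by
      rw [e]
      exact hreg
    exact hreg'

/-- **EL♮ FOR THE CUSPIDAL CUBIC CONE THROUGH THE REGISTERED RUNG** (`K` algebraically closed of characteristic `p`, ANY `p`):
`ELNatAt p K 3 H ι` for `H = V₊(x₀x₂² − x₃³)` — `stub_elnat_ciNoseThenPoints` (p524326) applied to `ciNoseThenPoints_hypothesis_cuspCone`, the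
locally-principal binder discharged by `HypersurfaceSpecimen.locallyPrincipal_hypersurfaceι` (all four dehomogenisations `g₀…g₃` span radical ideals),
then `elNatAt_of_horizAt`. A surface whose double line carries a TRIPLE point (non-equimultiple nose) — EL♮ in OUR kernel, every `p`.
[OURS · L1 W4.5b] [folklore] -/
theorem elNatAt_cuspCone_of_ciNose (p : ℕ) (hp : p.Prime) (K : Type) [Field K] [CharP K p] [IsAlgClosed K] :
    Theorems.EquisingularLift.ELNatAt p K 3 (hypersurface (CuspCone.form K)).left (hypersurfaceι (CuspCone.form K)).left := by
  haveI := isIntegral_hypersurface K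
  have hrad : ∀ c : Fin (2 + 2), (Ideal.span {dehomogenize K c (CuspCone.form K)}).radical = Ideal.span {dehomogenize K c (CuspCone.form K)} := by
    intro c
    fin_cases c
    · exact (congrArg (fun q => (Ideal.span {q}).radical) (dehomogenize_form_zero K)).trans
        ((radical_span_g₀ K).trans (congrArg (fun q => Ideal.span {q}) (dehomogenize_form_zero K).symm))
    · exact (congrArg (fun q => (Ideal.span {q}).radical) (dehomogenize_form_one K)).trans
        ((radical_span_g₁ K).trans (congrArg (fun q => Ideal.span {q}) (dehomogenize_form_one K).symm))
    · exact (congrArg (fun q => (Ideal.span {q}).radical) (dehomogenize_form_two K)).trans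
        ((radical_span_g₂ K).trans (congrArg (fun q => Ideal.span {q}) (dehomogenize_form_two K).symm))
    · exact (congrArg (fun q => (Ideal.span {q}).radical) (dehomogenize_form_three K)).trans
        ((radical_span_g₃ K).trans (congrArg (fun q => Ideal.span {q}) (dehomogenize_form_three K).symm))
  exact Summit.ResolutionOfSingularities.ResolutionOfSingularities.Theorems.EquisingularLiftNatResidualCut.elNatAt_of_horizAt
    p K 3 _ _ inferInstance inferInstance
    (stub_elnat_ciNoseThenPoints p hp K 3 _ _ inferInstance inferInstance
      (HypersurfaceSpecimen.locallyPrincipal_hypersurfaceι (CuspCone.form K) (isHomogeneous_form K) three_pos hrad)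
      (ciNoseThenPoints_hypothesis_cuspCone K))

end CuspCone

end Summit.ResolutionOfSingularities.ResolutionOfSingularities.Cruxes.EquisingularLiftNat.Sections

end
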